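import Literature.AlgebraicGeometry.Motives.HodgeLieOfAbelianVarietyBiproduct
import Literature.AlgebraicGeometry.Motives.HodgeLieMultiplicities
import HarnessLib

/-!
# `dim Lie Hg(H¹(⨁_{(i,k)} B_i)) = dim Lie Hg(H¹(⨁_i B_i))`: the Hodge group of a complex abelian variety depends only on
# its simple factors, not on their multiplicities (Moonen–Zarhin 1999 §1), Lie-algebra dimension form

Family `hodge`, layer `Literature/AlgebraicGeometry/Motives`; THEOREMS ONLY (no definition, no named fact).  Written for
the cell `pub-hodgecm2` (COR-CM), seat `b27` gen 43 (count-neutral Mumford–Tate-rank ladder).  The complex-abelian-variety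
form of `Motives/HodgeLieMultiplicities` (`dim 𝔥(⊕_{(i,k)} H_i) = dim 𝔥(⊕_i H_i)` for pure `ℚ`-Hodge structures), transported
along Künneth in degree one (`pi_hodge_one_eq_comapEquiv_biproduct`: `H¹(⨁ A_j) ≅ ⊕_j H¹(A_j)`) and isogeny invariance
(`finrank_hodgeLie_hodge_one_eq_of_isIsogenous`); generalises `Motives/HodgeLieOfAbelianVarietyPower` (one factor).

* **`finrank_hodgeLie_hodge_one_biproduct_sigma_eq`** — `dim Lie Hg(H¹(⨁_{(i,k) : Σ i, m_i} B_i)) = dim Lie Hg(H¹(⨁_i B_i))`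
  for nonempty finite multiplicity sets `m_i`;
* **`finrank_hodgeLie_hodge_one_eq_of_isIsogenous_biproduct_sigma`** — the same for every `X ∼ ⨁_{(i,k)} B_i` and
  `X' ∼ ⨁_i B_i`.

## References
* [MoonenZarhin1999LowDim] B. Moonen, Yu. Zarhin, Math. Ann. 315 (1999), §1 («we can identify `Hg(Xⁿ)` with `Hg(X)` acting
  diagonally») and §3 (3.1) [corpus: paper:arxiv-math_9901113 pp. 2, 6]. [cite: MoonenZarhin1999LowDim, §1 and §3]
* [Moonen1999MTNotes] B. Moonen, *Notes on Mumford–Tate groups* (1999), (1.8). [cite: Moonen1999MTNotes, (1.8)]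
* [VoisinHodgeI2002] C. Voisin, *Hodge Theory and Complex Algebraic Geometry I*, §7.3.2 and Thm. 11.38 (Künneth).
  [cite: VoisinHodgeI2002, §7.3.2]
-/

noncomputable section

open CategoryTheory CategoryTheory.Limits

namespace Literature.AlgebraicGeometry.Motives

namespace AbelianVariety

open Literature.AlgebraicGeometry.HodgeTheory
open Literature.AlgebraicGeometry.Motives.HodgeStructure

variable [HodgeTensorFacts.{0, 0}]
  {ι : Type} [Fintype ι] [DecidableEq ι] {m : ι → Type} [∀ i, Fintype (m i)] [∀ i, DecidableEq (m i)]
  [∀ i, Nonempty (m i)] {B : ι → AbelianVariety ℂ} {d : ι → ℕ} (hB : ∀ i, IsSmoothProjective (d i) (B i).X)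

include hB in
/-- **`dim Lie Hg(H¹(⨁_{(i,k)} B_i)) = dim Lie Hg(H¹(⨁_i B_i))`** — multiplicities of the factors do not change the dimension of
the Hodge Lie algebra (Künneth in degree one on both sides, `dim 𝔥(e^* H) = dim 𝔥(H)`, and
`HodgeStructure.finrank_hodgeLie_pi_sigma_eq`). [cite: MoonenZarhin1999LowDim, §1 and §3] [cite: Moonen1999MTNotes, (1.8)]
[cite: VoisinHodgeI2002, §7.3.2] -/
theorem finrank_hodgeLie_hodge_one_biproduct_sigma_eq {N N' : ℕ}
    (hP : IsSmoothProjective N (⨁ fun p : Σ i, m i => B p.1).X) (hQ : IsSmoothProjective N' (⨁ B).X) :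
    haveI := BettiUniverse.finite hP 1
    haveI := BettiUniverse.finite hQ 1
    Module.finrank ℚ (BettiUniverse.hodge exists_isReal_hodgeModel_holds hP 1).hodgeLie =
      Module.finrank ℚ (BettiUniverse.hodge exists_isReal_hodgeModel_holds hQ 1).hodgeLie := by
  haveI := BettiUniverse.finite hP 1
  haveI := BettiUniverse.finite hQ 1
  haveI : ∀ i, Module.Finite ℚ (bettiCohomology (B i).X 1) := fun i => BettiUniverse.finite (hB i) 1
  -- Künneth for `⨁_{(i,k)} B_i`
  have hpiP := pi_hodge_one_eq_comapEquiv_biproduct (A := fun p : Σ i, m i => B p.1) (fun p => hB p.1) hP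
    exists_isReal_hodgeModel_holds hodgePQ_independent_of_hodgeModel_holds
  have heqP := finrank_hodgeLie_comapEquiv (BettiUniverse.hodge exists_isReal_hodgeModel_holds hP 1)
    (LinearEquiv.ofBijective
      (∑ p, BettiUniverse.pull (biproduct.π (fun p : Σ i, m i => B p.1) p).hom.hom.hom 1 ∘ₗ LinearMap.proj p :
        (∀ p : Σ i, m i, bettiCohomology (B p.1).X 1) →ₗ[ℚ] bettiCohomology (⨁ fun p : Σ i, m i => B p.1).X 1)
      (bijective_sum_pull_biproduct_π fun p : Σ i, m i => B p.1))
  rw [← hpiP] at heqP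
  -- Künneth for `⨁_i B_i`
  have hpiQ := pi_hodge_one_eq_comapEquiv_biproduct (A := B) hB hQ
    exists_isReal_hodgeModel_holds hodgePQ_independent_of_hodgeModel_holds
  have heqQ := finrank_hodgeLie_comapEquiv (BettiUniverse.hodge exists_isReal_hodgeModel_holds hQ 1)
    (LinearEquiv.ofBijective
      (∑ i, BettiUniverse.pull (biproduct.π B i).hom.hom.hom 1 ∘ₗ LinearMap.proj i :
        (∀ i, bettiCohomology (B i).X 1) →ₗ[ℚ] bettiCohomology (⨁ B).X 1)
      (bijective_sum_pull_biproduct_π B))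
  rw [← hpiQ] at heqQ
  rw [← heqP, ← heqQ]
  exact finrank_hodgeLie_pi_sigma_eq fun i => BettiUniverse.hodge exists_isReal_hodgeModel_holds (hB i) 1

include hB in
/-- **`dim Lie Hg(H¹X) = dim Lie Hg(H¹X')` for `X ∼ ⨁_{(i,k)} B_i` and `X' ∼ ⨁_i B_i`**: the Hodge Lie algebra dimension of a
complex abelian variety depends only on the SET of factors `B_i`, not on their multiplicities (isogeny invariance and
`finrank_hodgeLie_hodge_one_biproduct_sigma_eq`). [cite: MoonenZarhin1999LowDim, §1 and §3] [cite: Moonen1999MTNotes, (1.8)] -/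
theorem finrank_hodgeLie_hodge_one_eq_of_isIsogenous_biproduct_sigma {X X' : AbelianVariety ℂ} {n n' : ℕ}
    (hX : IsSmoothProjective n X.X) (hX' : IsSmoothProjective n' X'.X)
    (h : IsIsogenous X (⨁ fun p : Σ i, m i => B p.1)) (h' : IsIsogenous X' (⨁ B)) :
    haveI := BettiUniverse.finite hX 1
    haveI := BettiUniverse.finite hX' 1
    Module.finrank ℚ (BettiUniverse.hodge exists_isReal_hodgeModel_holds hX 1).hodgeLie =
      Module.finrank ℚ (BettiUniverse.hodge exists_isReal_hodgeModel_holds hX' 1).hodgeLie := by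
  have hP : IsSmoothProjective (⨁ fun p : Σ i, m i => B p.1).dim (⨁ fun p : Σ i, m i => B p.1).X :=
    AbelianVariety.isSmoothProjective_holds
  have hQ : IsSmoothProjective (⨁ B).dim (⨁ B).X := AbelianVariety.isSmoothProjective_holds
  rw [finrank_hodgeLie_hodge_one_eq_of_isIsogenous hX hP h, finrank_hodgeLie_hodge_one_eq_of_isIsogenous hX' hQ h']
  exact finrank_hodgeLie_hodge_one_biproduct_sigma_eq hB hP hQ

end AbelianVariety

end Literature.AlgebraicGeometry.Motives

end
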